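import Summits.NavierStokesRegularity.NavierStokesRegularity.Theorems.QuarterJoltFrameFluxBound
import Literature.Analysis.FluidPDE.ClassicalLocalEnergyCutoff
import Literature.Analysis.FluidPDE.NSLerayHopfABCTrajectory

set_option linter.dupNamespace false

/-!
# Route QuarterJolt — crux `NoTerminalJolt` (stmt-NavierStokesRegularity-26463), LEAD line
# `regular_split`: TIGHTNESS OF THE ENERGY AT SPATIAL INFINITY in the frame

Seat ns-ntj-p1 g5 (LEAD of the crux; `--supports 26463 --as helper`).

* `NoTerminalJolt.tight_energy_of_frame` — for `(u,p)` classical on `[0,T)` with viscosity `ν > 0`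
  and Leray–Hopf on `[0,T]`: for every `ε > 0` there is a radius `R` such that
  `∫_{‖x‖ ≥ R} |u(t,x)|² dx ≤ ε` for ALL `t ∈ [T/2, T)` — no energy escapes to spatial infinity as
  `t ↑ T` (blow-up time or not).

PROOF (Leray's far-field energy estimate, in cut-off form). With the dilated cut-offs `χ_R` of
`QuarterJoltFrameFluxBound` and the classical local energy identity below `T`
(`IsClassicalNSSolutionOn.local_energy_identity_cutoff`) applied to `χ_R` and to `χ_{R'}`, `R' ≥ 2R`,
on `[T/2, t]`: the difference of the two identities gives
`∫(χ_{R'} − χ_R)|u(t)|² ≤ ∫(χ_{R'} − χ_R)|u(T/2)|² + ∫₀ᵀ|F_{χ_R}| + ∫₀ᵀ|F_{χ_{R'}}|` (the localised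
dissipations compare the right way since `χ_R ≤ χ_{R'}`), and the flux integrals are
`≤ (A₁/R² + B₁/R)·K` (`exists_lintegral_flux_le`); the annulus `{2R ≤ ‖x‖ ≤ R'}` is then let go to
infinity (`tendsto_setIntegral_of_monotone`) and the tail of the single slice `u(T/2)` is small for
`R` large (`tendsto_setIntegral_of_antitone`). No Type-I or decay hypothesis on the datum is used
beyond the Leray–Hopf class.

USE (sequel file): with the uniform-integrability theorem `QuarterJoltLocalEnergyContinuityOfUI`
(18118-type UI ⇒ `L²_loc` convergence at `T`) tightness upgrades local to GLOBAL strong convergence: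
`NoFastEnergyConcentration` (stmt-18118) ⇒ energy equality at every frame time = stub 3 of the line.

HONEST FRAMING: a structural lemma about frame solutions; nothing here proves any crux or
Navier–Stokes regularity. [cite: Leray1934, §32; CaffarelliKohnNirenberg1982, §2 (2.5); LeslieShvydkoy2017, §4]
-/

noncomputable section

open MeasureTheory TopologicalSpace Set Function Filter Metric
open _root_.Topology
open scoped Laplacian InnerProductSpace RealInnerProductSpace ENNReal NNReal ContDiff

namespace Summit.NavierStokesRegularity.NavierStokesRegularity.Theorems.NoTerminalJolt

open Literature.Analysis.FluidPDE
open Summit.NavierStokesRegularity.NavierStokesRegularity.Theorems.TypeITraceScarL3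

/-- **TIGHTNESS OF THE ENERGY AT SPATIAL INFINITY.** For `(u,p)` classical on `[0,T)` with viscosity
`ν > 0`, Leray–Hopf on `[0,T]`: `∀ ε > 0 ∃ R > 0 ∀ t ∈ [T/2, T): ∫_{‖x‖ ≥ R} |u(t,x)|² dx ≤ ε`.
(Leray's far-field energy estimate via the local energy identity with dilated cut-offs; module
docstring.) [cite: Leray1934, §32; CaffarelliKohnNirenberg1982, §2 (2.5)] -/
theorem tight_energy_of_frame {ν T : ℝ} (hν : 0 < ν) (hT : 0 < T)
    {u : ℝ → EuclideanSpace ℝ (Fin 3) → EuclideanSpace ℝ (Fin 3)}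
    {p : ℝ → EuclideanSpace ℝ (Fin 3) → ℝ}
    (hcl : IsClassicalNSSolutionOn (Set.Ico 0 T) ν 0 u p) (hLH : IsLerayHopfOn T ν 0 (u 0) u)
    {ε : ℝ} (hε : 0 < ε) :
    ∃ R : ℝ, 0 < R ∧ ∀ t ∈ Ico (T / 2) T,
      ∫ x in {x : EuclideanSpace ℝ (Fin 3) | R ≤ ‖x‖}, ‖u t x‖ ^ 2 ≤ ε := by
  classical
  have hcl' : IsClassicalNSSolutionOn (Ioo 0 T) ν 0 u p :=
    hcl.mono Ioo_subset_Ico_self isOpen_Ioo.uniqueDiffOn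
  obtain ⟨K, hKt, hflux⟩ := exists_lintegral_flux_le hν hT hcl hLH
  obtain ⟨χ, A₁, B₁, hA₁, hB₁, hχ⟩ := exists_cutoffFamily
  set t₁ : ℝ := T / 2 with ht₁
  have ht₁I : t₁ ∈ Ioo 0 T := ⟨by rw [ht₁]; positivity, by rw [ht₁]; linarith⟩
  have ht₁0 : t₁ ∈ Ico 0 T := ⟨ht₁I.1.le, ht₁I.2⟩
  -- the flux as an opaque function of (radius, time)
  obtain ⟨F, hF⟩ : ∃ F : ℝ → ℝ → ℝ, ∀ r s, F r s = ∫ x, (ν * ((Δ (χ r)) x * ‖u s x‖ ^ 2) +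
      fderiv ℝ (χ r) x (u s x) * ‖u s x‖ ^ 2 + 2 * (p s x * fderiv ℝ (χ r) x (u s x))) :=
    ⟨fun r s => ∫ x, (ν * ((Δ (χ r)) x * ‖u s x‖ ^ 2) +
      fderiv ℝ (χ r) x (u s x) * ‖u s x‖ ^ 2 + 2 * (p s x * fderiv ℝ (χ r) x (u s x))),
      fun _ _ => rfl⟩
  -- ### slices
  have hsq : ∀ s ∈ Ico 0 T, Integrable (fun x => ‖u s x‖ ^ 2) volume := fun s hs =>
    (hLH.memLp s ⟨hs.1, hs.2.le⟩).integrable_norm_pow two_ne_zero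
  have hLint : ∀ r, 0 < r → ∀ s ∈ Ico 0 T, Integrable (fun x => χ r x * ‖u s x‖ ^ 2) volume := by
    intro r hr s hs
    refine (hsq s hs).bdd_mul (c := 1) (hχ r hr).1.continuous.aestronglyMeasurable
      (ae_of_all _ fun x => ?_)
    rw [Real.norm_eq_abs, abs_of_nonneg ((hχ r hr).2.2.1 x)]
    exact (hχ r hr).2.2.2.1 x
  -- pointwise order of the cut-offs: `χ_R ≤ χ_{r'}` for `r' ≥ 2R`
  have hχle : ∀ R r' : ℝ, 0 < R → 2 * R ≤ r' → ∀ x, χ R x ≤ χ r' x := by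
    intro R r' hR hRr' x
    have hr' : 0 < r' := by linarith
    by_cases hx : ‖x‖ ≤ r'
    · rw [(hχ r' hr').2.2.2.2.1 x hx]; exact (hχ R hR).2.2.2.1 x
    · rw [(hχ R hR).2.2.2.2.2.1 x (by linarith [not_le.1 hx])]; exact (hχ r' hr').2.2.1 x
  -- ### (1) the flux: integrable on `(0,T)`, with `∫₀ᵀ |F_r| ≤ bnd r`
  have hFint : ∀ r, 0 < r → IntegrableOn (F r) (Ioo 0 T) := by
    intro r hr
    exact (integrableOn_flux_Ioo hν hT hcl hLH (hχ r hr).1 (hχ r hr).2.1).congr_fun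
      (fun s _ => (hF r s).symm) measurableSet_Ioo
  have hbnd_fin : ∀ r : ℝ, (ENNReal.ofReal (A₁ / r ^ 2) + ENNReal.ofReal (B₁ / r)) * K ≠ ⊤ :=
    fun r => ENNReal.mul_ne_top (ENNReal.add_ne_top.2 ⟨ENNReal.ofReal_ne_top, ENNReal.ofReal_ne_top⟩) hKt
  obtain ⟨bnd, hbnd⟩ : ∃ bnd : ℝ → ℝ, ∀ r, bnd r =
      ((ENNReal.ofReal (A₁ / r ^ 2) + ENNReal.ofReal (B₁ / r)) * K).toReal := ⟨_, fun _ => rfl⟩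
  have hbnd0 : ∀ r, 0 ≤ bnd r := fun r => by rw [hbnd]; exact ENNReal.toReal_nonneg
  have hFle : ∀ r, 0 < r → ∫ s in Ioo 0 T, |F r s| ≤ bnd r := by
    intro r hr
    have h1 : ∫ s in Ioo 0 T, |F r s| = (∫⁻ s in Ioo 0 T, ‖F r s‖ₑ).toReal := by
      rw [← integral_norm_eq_lintegral_enorm (hFint r hr).aestronglyMeasurable]
      simp only [Real.norm_eq_abs]
    have h2 : ∫⁻ s in Ioo 0 T, ‖F r s‖ₑ ≤ (ENNReal.ofReal (A₁ / r ^ 2) + ENNReal.ofReal (B₁ / r)) * K := by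
      have h := hflux (χ r) (hχ r hr).1 (hχ r hr).2.1 (A₁ / r ^ 2) (B₁ / r)
        (hχ r hr).2.2.2.2.2.2.1 (hχ r hr).2.2.2.2.2.2.2
      refine le_of_eq_of_le (lintegral_congr fun s => by rw [hF]) h
    rw [h1, hbnd]
    exact ENNReal.toReal_mono (hbnd_fin r) h2
  have hbnd_mono : ∀ r r' : ℝ, 0 < r → r ≤ r' → bnd r' ≤ bnd r := by
    intro r r' hr hrr'
    rw [hbnd, hbnd]
    refine ENNReal.toReal_mono (hbnd_fin r) (mul_le_mul' (add_le_add (ENNReal.ofReal_le_ofReal ?_)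
      (ENNReal.ofReal_le_ofReal ?_)) le_rfl)
    · exact div_le_div_of_nonneg_left hA₁ (by positivity) (pow_le_pow_left₀ hr.le hrr' 2)
    · exact div_le_div_of_nonneg_left hB₁ hr hrr'
  have hbnd_tendsto : Tendsto (fun n : ℕ => bnd (n : ℝ)) atTop (𝓝 0) := by
    have h1 : Tendsto (fun n : ℕ => A₁ / (n : ℝ) ^ 2) atTop (𝓝 0) :=
      tendsto_const_nhds.div_atTop ((tendsto_pow_atTop two_ne_zero).comp tendsto_natCast_atTop_atTop)
    have h2 : Tendsto (fun n : ℕ => B₁ / (n : ℝ)) atTop (𝓝 0) :=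
      tendsto_const_nhds.div_atTop tendsto_natCast_atTop_atTop
    have h3 : Tendsto (fun n : ℕ => ENNReal.ofReal (A₁ / (n : ℝ) ^ 2) + ENNReal.ofReal (B₁ / (n : ℝ)))
        atTop (𝓝 0) := by
      have h := (ENNReal.tendsto_ofReal h1).add (ENNReal.tendsto_ofReal h2)
      rwa [ENNReal.ofReal_zero, add_zero] at h
    have h4 : Tendsto (fun n : ℕ => (ENNReal.ofReal (A₁ / (n : ℝ) ^ 2) +
        ENNReal.ofReal (B₁ / (n : ℝ))) * K) atTop (𝓝 0) := by
      have h := ENNReal.Tendsto.mul_const h3 (Or.inr hKt)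
      rwa [zero_mul] at h
    have h5 := (ENNReal.tendsto_toReal ENNReal.zero_ne_top).comp h4
    rw [ENNReal.toReal_zero] at h5
    refine h5.congr fun n => ?_
    rw [Function.comp_apply, hbnd]
  -- ### (2) the two-cutoff comparison below `T`
  have hcomp : ∀ t ∈ Ico t₁ T, ∀ R r' : ℝ, 0 < R → 2 * R ≤ r' →
      (∫ x, χ r' x * ‖u t x‖ ^ 2) - (∫ x, χ R x * ‖u t x‖ ^ 2) ≤
        (∫ x in {x : EuclideanSpace ℝ (Fin 3) | R ≤ ‖x‖}, ‖u t₁ x‖ ^ 2) + bnd r' + bnd R := by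
    intro t ht R r' hR hRr'
    have hr' : 0 < r' := by linarith
    have htI : Icc t₁ t ⊆ Ioo 0 T := fun s hs => ⟨ht₁I.1.trans_le hs.1, hs.2.trans_lt ht.2⟩
    -- the two local energy identities on `[t₁, t]`
    have idR := hcl'.local_energy_identity_cutoff isOpen_Ioo (hχ R hR).1 (hχ R hR).2.1 ht.1 htI
    have idr := hcl'.local_energy_identity_cutoff isOpen_Ioo (hχ r' hr').1 (hχ r' hr').2.1 ht.1 htI
    have eR : (fun s => ∫ x, (ν * ((Δ (χ R)) x * ‖u s x‖ ^ 2) +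
        fderiv ℝ (χ R) x (u s x) * ‖u s x‖ ^ 2 + 2 * (p s x * fderiv ℝ (χ R) x (u s x)))) = F R :=
      funext fun s => (hF R s).symm
    have er : (fun s => ∫ x, (ν * ((Δ (χ r')) x * ‖u s x‖ ^ 2) +
        fderiv ℝ (χ r') x (u s x) * ‖u s x‖ ^ 2 + 2 * (p s x * fderiv ℝ (χ r') x (u s x)))) = F r' :=
      funext fun s => (hF r' s).symm
    rw [eR] at idR
    rw [er] at idr
    -- the localised dissipations compare: `∫∫ |∇u|² χ_R ≤ ∫∫ |∇u|² χ_{r'}`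
    have hGle : ∫ s in t₁..t, ∫ x, frobeniusNormSq (fderiv ℝ (u s) x) * χ R x ≤
        ∫ s in t₁..t, ∫ x, frobeniusNormSq (fderiv ℝ (u s) x) * χ r' x := by
      have cR := hcl'.continuousOn_integral_dissipation_cutoff isOpen_Ioo
        (hχ R hR).1.continuous (hχ R hR).2.1
      have cr := hcl'.continuousOn_integral_dissipation_cutoff isOpen_Ioo
        (hχ r' hr').1.continuous (hχ r' hr').2.1
      have hu : uIcc t₁ t ⊆ Ioo 0 T := by rw [uIcc_of_le ht.1]; exact htI
      refine intervalIntegral.integral_mono_on ht.1 (cR.mono hu).intervalIntegrable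
        (cr.mono hu).intervalIntegrable fun s hs => ?_
      have hsI : s ∈ Ico 0 T := ⟨(htI hs).1.le, (htI hs).2⟩
      have hu1 : ContDiff ℝ 1 (u s) := (hcl.contDiff_velocity hsI).of_le (by norm_cast)
      have hcont : Continuous fun x => frobeniusNormSq (fderiv ℝ (u s) x) :=
        AlbrittonBrueColombo2022.continuous_frobeniusNormSq_fderiv' hu1
      refine integral_mono
        ((hcont.mul (hχ R hR).1.continuous).integrable_of_hasCompactSupport (hχ R hR).2.1.mul_left)
        ((hcont.mul (hχ r' hr').1.continuous).integrable_of_hasCompactSupport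
          (hχ r' hr').2.1.mul_left)
        fun x => mul_le_mul_of_nonneg_left (hχle R r' hR hRr' x) (frobeniusNormSq_nonneg _)
    have hG2 := mul_le_mul_of_nonneg_left hGle (by positivity : (0 : ℝ) ≤ 2 * ν)
    -- the flux terms
    have hsub : Ioc t₁ t ⊆ Ioo 0 T := fun s hs => ⟨ht₁I.1.trans hs.1, lt_of_le_of_lt hs.2 ht.2⟩
    have hFR : -(∫ s in t₁..t, F R s) ≤ bnd R := by
      rw [intervalIntegral.integral_of_le ht.1]
      have hi : IntegrableOn (F R) (Ioc t₁ t) := (hFint R hR).mono_set hsub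
      calc -(∫ s in Ioc t₁ t, F R s) ≤ ∫ s in Ioc t₁ t, |F R s| := by
            rw [← integral_neg]
            exact integral_mono hi.neg hi.abs fun s => neg_le_abs _
        _ ≤ ∫ s in Ioo 0 T, |F R s| :=
            setIntegral_mono_set (hFint R hR).abs (ae_of_all _ fun s => abs_nonneg _)
              hsub.eventuallyLE
        _ ≤ bnd R := hFle R hR
    have hFr : (∫ s in t₁..t, F r' s) ≤ bnd r' := by
      rw [intervalIntegral.integral_of_le ht.1]
      have hi : IntegrableOn (F r') (Ioc t₁ t) := (hFint r' hr').mono_set hsub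
      calc (∫ s in Ioc t₁ t, F r' s) ≤ ∫ s in Ioc t₁ t, |F r' s| :=
            integral_mono hi hi.abs fun s => le_abs_self _
        _ ≤ ∫ s in Ioo 0 T, |F r' s| :=
            setIntegral_mono_set (hFint r' hr').abs (ae_of_all _ fun s => abs_nonneg _)
              hsub.eventuallyLE
        _ ≤ bnd r' := hFle r' hr'
    -- the initial slice
    have hmeasA : MeasurableSet {x : EuclideanSpace ℝ (Fin 3) | R ≤ ‖x‖} :=
      (isClosed_le continuous_const continuous_norm).measurableSet
    have hinit : (∫ x, χ r' x * ‖u t₁ x‖ ^ 2) - (∫ x, χ R x * ‖u t₁ x‖ ^ 2) ≤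
        ∫ x in {x : EuclideanSpace ℝ (Fin 3) | R ≤ ‖x‖}, ‖u t₁ x‖ ^ 2 := by
      rw [← integral_sub (hLint r' hr' t₁ ht₁0) (hLint R hR t₁ ht₁0), ← integral_indicator hmeasA]
      refine integral_mono ((hLint r' hr' t₁ ht₁0).sub (hLint R hR t₁ ht₁0))
        ((hsq t₁ ht₁0).indicator hmeasA) fun x => ?_
      by_cases hx : R ≤ ‖x‖
      · rw [indicator_of_mem (show x ∈ {x : EuclideanSpace ℝ (Fin 3) | R ≤ ‖x‖} from hx)]
        nlinarith [(hχ r' hr').2.2.2.1 x, (hχ R hR).2.2.1 x, sq_nonneg ‖u t₁ x‖]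
      · rw [indicator_of_notMem (show x ∉ {x : EuclideanSpace ℝ (Fin 3) | R ≤ ‖x‖} from hx),
          (hχ R hR).2.2.2.2.1 x (not_le.1 hx).le]
        nlinarith [(hχ r' hr').2.2.2.1 x, sq_nonneg ‖u t₁ x‖]
    linarith [idR, idr, hG2, hFR, hFr, hinit]
  -- ### (3) the annuli `{2R ≤ ‖x‖ ≤ n}`
  have hmeasS : ∀ (R : ℝ) (n : ℕ),
      MeasurableSet {x : EuclideanSpace ℝ (Fin 3) | 2 * R ≤ ‖x‖ ∧ ‖x‖ ≤ (n : ℝ)} := fun R n =>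
    ((isClosed_le continuous_const continuous_norm).inter
      (isClosed_le continuous_norm continuous_const)).measurableSet
  have hann : ∀ t ∈ Ico t₁ T, ∀ R : ℝ, 0 < R → ∀ n : ℕ, 2 * R ≤ (n : ℝ) →
      ∫ x in {x : EuclideanSpace ℝ (Fin 3) | 2 * R ≤ ‖x‖ ∧ ‖x‖ ≤ (n : ℝ)}, ‖u t x‖ ^ 2 ≤
        (∫ x in {x : EuclideanSpace ℝ (Fin 3) | R ≤ ‖x‖}, ‖u t₁ x‖ ^ 2) + bnd (n : ℝ) + bnd R := by
    intro t ht R hR n hn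
    have htI0 : t ∈ Ico 0 T := ⟨ht₁0.1.trans ht.1, ht.2⟩
    have hn0 : 0 < (n : ℝ) := by linarith
    refine le_trans ?_ (hcomp t ht R n hR hn)
    rw [← integral_indicator (hmeasS R n),
      ← integral_sub (hLint _ hn0 t htI0) (hLint R hR t htI0)]
    refine integral_mono ((hsq t htI0).indicator (hmeasS R n))
      ((hLint _ hn0 t htI0).sub (hLint R hR t htI0)) fun x => ?_
    by_cases hx : x ∈ {x : EuclideanSpace ℝ (Fin 3) | 2 * R ≤ ‖x‖ ∧ ‖x‖ ≤ (n : ℝ)}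
    · rw [indicator_of_mem hx, (hχ _ hn0).2.2.2.2.1 x hx.2, (hχ R hR).2.2.2.2.2.1 x hx.1]
      linarith
    · rw [indicator_of_notMem hx]
      nlinarith [hχle R n hR hn x, sq_nonneg ‖u t x‖]
  -- ### (4) the choice of the radius
  -- the tail of the single slice `u(t₁)` is small
  have htail : Tendsto (fun k : ℕ => ∫ x in {x : EuclideanSpace ℝ (Fin 3) | (k : ℝ) ≤ ‖x‖},
      ‖u t₁ x‖ ^ 2) atTop (𝓝 0) := by
    have hanti : Antitone fun k : ℕ => {x : EuclideanSpace ℝ (Fin 3) | (k : ℝ) ≤ ‖x‖} :=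
      fun k m hkm x hx => show (k : ℝ) ≤ ‖x‖ from
        le_trans (Nat.cast_le.2 hkm) (show (m : ℝ) ≤ ‖x‖ from hx)
    have h := tendsto_setIntegral_of_antitone (μ := volume) (f := fun x => ‖u t₁ x‖ ^ 2)
      (fun k => (isClosed_le continuous_const continuous_norm).measurableSet) hanti
      ⟨0, (hsq t₁ ht₁0).integrableOn⟩
    have hempty : (⋂ k : ℕ, {x : EuclideanSpace ℝ (Fin 3) | (k : ℝ) ≤ ‖x‖}) = ∅ := by
      ext x
      simp only [mem_iInter, mem_setOf_eq, mem_empty_iff_false, iff_false, not_forall, not_le]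
      exact exists_nat_gt ‖x‖
    rwa [hempty, Measure.restrict_empty, integral_zero_measure] at h
  obtain ⟨k₁, hk₁⟩ := (htail.eventually (Iic_mem_nhds (show (0 : ℝ) < ε / 4 by positivity))).exists_forall_of_atTop
  obtain ⟨k₂, hk₂⟩ := (hbnd_tendsto.eventually
    (Iic_mem_nhds (show (0 : ℝ) < ε / 4 by positivity))).exists_forall_of_atTop
  set k : ℕ := max (max k₁ k₂) 1 with hk
  have hk1 : k₁ ≤ k := (le_max_left _ _).trans (le_max_left _ _)
  have hk2 : k₂ ≤ k := (le_max_right _ _).trans (le_max_left _ _)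
  have hkpos : 0 < (k : ℝ) := by exact_mod_cast lt_of_lt_of_le one_pos (le_max_right _ _)
  have htail_k : ∫ x in {x : EuclideanSpace ℝ (Fin 3) | (k : ℝ) ≤ ‖x‖}, ‖u t₁ x‖ ^ 2 ≤ ε / 4 :=
    hk₁ k hk1
  have hbnd_k : bnd (k : ℝ) ≤ ε / 4 := hk₂ k hk2
  refine ⟨2 * k, by positivity, fun t ht => ?_⟩
  have htI0 : t ∈ Ico 0 T := ⟨ht₁0.1.trans ht.1, ht.2⟩
  -- the annuli exhaust `{2k ≤ ‖x‖}`
  have hmono : Monotone fun n : ℕ =>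
      {x : EuclideanSpace ℝ (Fin 3) | 2 * (k : ℝ) ≤ ‖x‖ ∧ ‖x‖ ≤ (n : ℝ)} := by
    intro n m hnm x hx
    have hx' : 2 * (k : ℝ) ≤ ‖x‖ ∧ ‖x‖ ≤ (n : ℝ) := hx
    exact show 2 * (k : ℝ) ≤ ‖x‖ ∧ ‖x‖ ≤ (m : ℝ) from ⟨hx'.1, hx'.2.trans (Nat.cast_le.2 hnm)⟩
  have hunion : (⋃ n : ℕ, {x : EuclideanSpace ℝ (Fin 3) | 2 * (k : ℝ) ≤ ‖x‖ ∧ ‖x‖ ≤ (n : ℝ)}) =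
      {x : EuclideanSpace ℝ (Fin 3) | 2 * (k : ℝ) ≤ ‖x‖} := by
    ext x
    simp only [mem_iUnion, mem_setOf_eq]
    constructor
    · rintro ⟨n, hn⟩; exact hn.1
    · intro hx
      obtain ⟨n, hn⟩ := exists_nat_ge ‖x‖
      exact ⟨n, hx, hn⟩
  have hlim := tendsto_setIntegral_of_monotone (μ := volume) (f := fun x => ‖u t x‖ ^ 2)
    (hmeasS k) hmono (by rw [hunion]; exact (hsq t htI0).integrableOn)
  rw [hunion] at hlim
  refine le_of_tendsto hlim (eventually_atTop.2 ⟨2 * k, fun n hn => ?_⟩)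
  have hn : 2 * (k : ℝ) ≤ (n : ℝ) := by exact_mod_cast hn
  have hbn : bnd (n : ℝ) ≤ bnd (k : ℝ) := hbnd_mono k n hkpos (by linarith)
  calc ∫ x in {x : EuclideanSpace ℝ (Fin 3) | 2 * (k : ℝ) ≤ ‖x‖ ∧ ‖x‖ ≤ (n : ℝ)}, ‖u t x‖ ^ 2
      ≤ (∫ x in {x : EuclideanSpace ℝ (Fin 3) | (k : ℝ) ≤ ‖x‖}, ‖u t₁ x‖ ^ 2) + bnd (n : ℝ) +
          bnd (k : ℝ) := hann t ht k hkpos n hn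
    _ ≤ ε / 4 + ε / 4 + ε / 4 := by linarith
    _ ≤ ε := by linarith

/-- **Tightness, lower-integral form**: under the same hypotheses, `∀ ε > 0 ∃ R > 0 ∀ t ∈ [T/2,T):
∫⁻_{‖x‖ ≥ R} ‖u(t,x)‖ₑ² ≤ ofReal ε`. -/
theorem tight_energy_of_frame_lintegral {ν T : ℝ} (hν : 0 < ν) (hT : 0 < T)
    {u : ℝ → EuclideanSpace ℝ (Fin 3) → EuclideanSpace ℝ (Fin 3)}
    {p : ℝ → EuclideanSpace ℝ (Fin 3) → ℝ}
    (hcl : IsClassicalNSSolutionOn (Set.Ico 0 T) ν 0 u p) (hLH : IsLerayHopfOn T ν 0 (u 0) u)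
    {ε : ℝ} (hε : 0 < ε) :
    ∃ R : ℝ, 0 < R ∧ ∀ t ∈ Ico (T / 2) T,
      ∫⁻ x in {x : EuclideanSpace ℝ (Fin 3) | R ≤ ‖x‖}, ‖u t x‖ₑ ^ 2 ≤ ENNReal.ofReal ε := by
  obtain ⟨R, hR, h⟩ := tight_energy_of_frame hν hT hcl hLH hε
  refine ⟨R, hR, fun t ht => ?_⟩
  have hmem : MemLp (u t) 2 volume := hLH.memLp t ⟨(by linarith [ht.1] : (0 : ℝ) ≤ t), ht.2.le⟩
  have hint : Integrable (fun x => ‖u t x‖ ^ 2) (volume.restrict {x : EuclideanSpace ℝ (Fin 3) | R ≤ ‖x‖}) :=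
    (hmem.integrable_norm_pow two_ne_zero).integrableOn
  have heq : ∫⁻ x in {x : EuclideanSpace ℝ (Fin 3) | R ≤ ‖x‖}, ‖u t x‖ₑ ^ 2 =
      ENNReal.ofReal (∫ x in {x : EuclideanSpace ℝ (Fin 3) | R ≤ ‖x‖}, ‖u t x‖ ^ 2) := by
    rw [integral_eq_lintegral_of_nonneg_ae (Eventually.of_forall fun x => sq_nonneg ‖u t x‖)
      hint.aestronglyMeasurable, ENNReal.ofReal_toReal hint.lintegral_lt_top.ne]
    exact lintegral_congr fun x => by rw [← ofReal_norm, ENNReal.ofReal_pow (norm_nonneg _)]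
  rw [heq]
  exact ENNReal.ofReal_le_ofReal (h t ht)

end Summit.NavierStokesRegularity.NavierStokesRegularity.Theorems.NoTerminalJolt

end
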